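import Literature.Computability.AlgebraicComplexity.HilbertMumfordSLForms
import Mathlib.RingTheory.MvPolynomial.WeightedHomogeneous
import HarnessLib

/-!
# Kempf's optimal one-parameter subgroups for `SL_σ`, I: torus weights on `Sym^D`, the graded
# vanishing ideal, and the monomial bookkeeping of parabolic subgroups (Kempf 1978 §2–§3 for
# `G = SL_σ`, `T` = diagonal torus, `X = Sym^D (K^σ)`)

First of three files formalising, for the group `SL_σ(K)` acting on forms by linear substitution
(`linSubst`, `slOrbit`, `IsPolystable`; `K` algebraically closed of ANY characteristic), Kempf's
theorem that a point whose orbit is not closed has a CANONICAL destabilising flag, stable under its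
stabiliser (G. R. Kempf, *Instability in invariant theory*, Ann. of Math. 108 (1978), Thm. 2.2,
Thm. 3.4, Cor. 4.4) — the input "Kempf's criterion" of Mulmuley–Sohoni 2001 Thms. 4.6/4.7
(`MS2001_thm_4_6`, `MS2001_thm_4_7`, typed as facts in `MS2001ClassVarieties.lean`).

This file contains the TORUS-THEORETIC bookkeeping, specialised to the diagonal torus of `SL_σ`
and the coordinates `y_d` (`d` a monomial of degree `D`, the finite type `DegIdx σ D`) of `Sym^D`:

* §1 `rpair`, `ipair`: the pairings `⟨a, m⟩ = ∑ a_i m_i` of real / integral weight vectors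
  (`X_*(T) ⊗ ℝ`, Kempf's real points of the cocharacter space with its `W`-invariant norm) with
  characters `m ∈ ℤ^σ`; `exists_traceless_ipair_ne_zero`: a cocharacter of `D_SL` (traceless `b`)
  separating finitely many non-zero traceless characters.
* §2 `twt d = N·d − D·𝟙`: the traceless weight recording the `D_SL`-character of `y_d`
  faithfully; isobaric = Mathlib's `IsWeightedHomogeneous (twt D)`; the scaling law
  `f(t^{Nb}·c) = t^{⟨b,m⟩} f(c)` for isobaric `f` of class `m` (`aeval_torus_of_isWeightedHomogeneous`).
* §4 **The vanishing ideal of a `D_SL`-stable subset of `Sym^D` is graded**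
  (`weightedHomogeneousComponent_mem_vanishingIdeal`, generic cocharacter + a one-variable
  polynomial with infinitely many roots; `K` infinite) and has **finitely many isobaric generators**
  (`exists_isobaric_span_vanishingIdeal`, Hilbert basis theorem) — the finitely many `T`-weights
  ("states") through which Kempf's numerical function is computed (Lemma 3.2).
* §5 `symPullback g`: the pullback `f ↦ f ∘ g` of test polynomials along the action of a matrix on
  `Sym^D` (`formCoeff_linSubst`, `aeval_formCoeff_symPullback`).
* §6 Weight bounds for substitutions (`weight_le_of_mem_support_aeval` and relatives): the single
  monomial computation behind Kempf's Lemma 3.2 (c) (`P(λ)`-invariance of the numerical function) and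
  behind the Weyl-group covariance — a matrix `q` with `a_i < a_j ⇒ q_{ij} = 0` (the parabolic
  `P_a`) RAISES the `a`-weights of monomials of `K[x]` (`le_weight_of_coeff_linSubst_monomial_ne_zero`),
  hence its pullback LOWERS the `a`-weights of test monomials
  (`rpair_weight_le_of_mem_support_symPullback`); a monomial matrix moves weights by its
  permutation (`weight_eq_of_coeff_linSubst_monomial_ne_zero_of_perm`).
* §7 `formCoeff D '' SL·Q` is `D_SL`-stable, so §4 applies to the ideal of an `SL`-orbit in `Sym^D`
  (`exists_isobaric_span_vanishingIdeal_slOrbit`), and `symPullback` by `SL` preserves that ideal.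

DEFINITIONS (with bodies; no named facts, nothing unproved): `rpair`, `rpairAddHom`, `ipair`,
`twt`, `symPullback`. Conventions: `linSubst A (X i) = ∑_j A j i • X j` (the tree's), so on
`Sym¹ = K^σ` the action is `Matrix.mulVec` and `P_a = {q : a_i < a_j ⇒ q i j = 0}`
(`Matrix.BlockTriangular q (toDual ∘ a)`) is the stabiliser of the flag `span{e_i : a_i ≥ r}`.
Honest framing: classical invariant theory in the tree's currency; nothing here bears on `VP` versus
`VNP`. Cell `val-lit`, seat t14 g7 (row MS2001-A residue), sequel of `HilbertMumfordSLForms.lean`.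

## References

* [Kempf1978] G. R. Kempf, *Instability in invariant theory*, Ann. of Math. (2) 108 (1978)
  299–316, §2 (length on `X_*(T) ⊗ ℝ`, `P(λ)`, Thm. 2.2), §3 (Lemma 3.2, Thm. 3.4) (cite-only, not
  held; the specialisation to `SL_σ` and `Sym^D` is ours).
* [MumfordFogartyKirwan1994] D. Mumford, J. Fogarty, F. Kirwan, *Geometric Invariant Theory*,
  3rd ed., Ch. 2 §1–§2 (held: `book:mumford1994-geometric-invariant-theory`, pp. 56–64).
* [MulmuleySohoniSIAM2001] K. Mulmuley, M. Sohoni, *GCT I*, SIAM J. Comput. 31 (2001), §3, proof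
  of Thms. 4.6/4.7 ("Kempf's criterion [23]").
-/

noncomputable section

open scoped BigOperators Polynomial
open MvPolynomial

namespace Literature.Computability.AlgebraicComplexity

variable {K : Type} [Field K] {σ : Type} [Fintype σ] {D : ℕ}

/-! ### §1. Pairings of cocharacters and characters of the diagonal torus -/

/-- The **real pairing** `⟨a, m⟩ = ∑ a_i m_i` of a real weight vector `a ∈ ℝ^σ` (a point of
`X_*(T) ⊗ ℝ`, Kempf's "virtual one-parameter subgroups") with an integral character `m ∈ ℤ^σ`.
[cite: Kempf1978, §2 (the pairing of one-parameter subgroups and characters)] -/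
def rpair (a : σ → ℝ) (m : σ → ℤ) : ℝ := ∑ i, a i * (m i : ℝ)

/-- Unfolding `rpair`. [cite: Kempf1978, §2] -/
theorem rpair_apply (a : σ → ℝ) (m : σ → ℤ) : rpair a m = ∑ i, a i * (m i : ℝ) := rfl

/-- `rpair a` is additive in the character. [cite: Kempf1978, §2] -/
theorem rpair_add (a : σ → ℝ) (m m' : σ → ℤ) : rpair a (m + m') = rpair a m + rpair a m' := by
  simp only [rpair_apply, Pi.add_apply, Int.cast_add, mul_add, Finset.sum_add_distrib]

/-- `rpair a 0 = 0`. [cite: Kempf1978, §2] -/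
theorem rpair_zero (a : σ → ℝ) : rpair a 0 = 0 := by
  simp [rpair_apply]

/-- `rpair a` as an additive homomorphism `ℤ^σ →+ ℝ`. [cite: Kempf1978, §2] -/
def rpairAddHom (a : σ → ℝ) : (σ → ℤ) →+ ℝ where
  toFun := rpair a
  map_zero' := rpair_zero a
  map_add' := rpair_add a

/-- Unfolding `rpairAddHom`. [cite: Kempf1978, §2] -/
theorem rpairAddHom_apply (a : σ → ℝ) (m : σ → ℤ) : rpairAddHom a m = rpair a m := rfl

/-- `rpair a (m − m') = rpair a m − rpair a m'`. [cite: Kempf1978, §2] -/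
theorem rpair_sub (a : σ → ℝ) (m m' : σ → ℤ) : rpair a (m - m') = rpair a m - rpair a m' :=
  map_sub (rpairAddHom a) m m'

/-- `rpair` of the weight of a monomial `y^e` is the `e`-combination of the pairings of the weights
of its variables. [cite: Kempf1978, §2] -/
theorem rpair_weight {τ : Type*} (a : σ → ℝ) (w : τ → σ → ℤ) (e : τ →₀ ℕ) :
    rpair a (Finsupp.weight w e) = ∑ t ∈ e.support, (e t : ℝ) * rpair a (w t) := by
  rw [Finsupp.weight_apply, Finsupp.sum, ← rpairAddHom_apply, map_sum]
  refine Finset.sum_congr rfl fun t _ => ?_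
  rw [map_nsmul, rpairAddHom_apply, nsmul_eq_mul]

/-- The **integral pairing** `⟨b, m⟩ = ∑ b_i m_i` of an integral cocharacter with a character.
[cite: Kempf1978, §2] -/
def ipair (b m : σ → ℤ) : ℤ := ∑ i, b i * m i

/-- Unfolding `ipair`. [cite: Kempf1978, §2] -/
theorem ipair_apply (b m : σ → ℤ) : ipair b m = ∑ i, b i * m i := rfl

/-- `rpair` of an integral weight vector is the cast of `ipair`. [cite: Kempf1978, §2] -/
theorem rpair_intCast (b m : σ → ℤ) : rpair (fun i => (b i : ℝ)) m = (ipair b m : ℝ) := by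
  simp [rpair_apply, ipair_apply]

/-- `ipair b` is additive. [cite: Kempf1978, §2] -/
theorem ipair_add (b m m' : σ → ℤ) : ipair b (m + m') = ipair b m + ipair b m' := by
  simp only [ipair_apply, Pi.add_apply, mul_add, Finset.sum_add_distrib]

/-- `ipair b (m − m')`. [cite: Kempf1978, §2] -/
theorem ipair_sub (b m m' : σ → ℤ) : ipair b (m - m') = ipair b m - ipair b m' := by
  simp only [ipair_apply, Pi.sub_apply, mul_sub, Finset.sum_sub_distrib]

/-- **A cocharacter of `D_SL` separating finitely many characters**: for finitely many non-zero
traceless `e ∈ ℤ^σ` there is a traceless `b ∈ ℤ^σ` with `⟨b, e⟩ ≠ 0` for all of them (a finite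
union of proper sublattices does not cover `X_*(D_SL)`). [cite: Kempf1978, §2 (weights of `T` on `X`)] -/
theorem exists_traceless_ipair_ne_zero (E : Finset (σ → ℤ))
    (hE : ∀ e ∈ E, ∑ i, e i = 0 ∧ e ≠ 0) :
    ∃ b : σ → ℤ, ∑ i, b i = 0 ∧ ∀ e ∈ E, ipair b e ≠ 0 := by
  classical
  induction E using Finset.induction_on with
  | empty => exact ⟨0, by simp, fun e he => absurd he (Finset.notMem_empty e)⟩
  | insert e₀ E he₀ ih =>
    obtain ⟨b₀, hb₀, hsep⟩ := ih fun e he => hE e (Finset.mem_insert_of_mem he)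
    obtain ⟨he₀tr, he₀ne⟩ := hE e₀ (Finset.mem_insert_self e₀ E)
    -- `⟨e₀, e₀⟩ > 0`
    have hpos : 0 < ipair e₀ e₀ := by
      rw [ipair_apply]
      obtain ⟨i, hi⟩ := Function.ne_iff.mp he₀ne
      rw [Pi.zero_apply] at hi
      exact lt_of_lt_of_le (mul_self_pos.mpr hi)
        (Finset.single_le_sum (f := fun j => e₀ j * e₀ j) (fun j _ => mul_self_nonneg (e₀ j))
          (Finset.mem_univ i))
    -- `b = b₀ + L • e₀` with `L` large
    set L : ℤ := 1 + |ipair b₀ e₀| + ∑ e ∈ E, |ipair b₀ e| with hL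
    have hsum0 : 0 ≤ ∑ e ∈ E, |ipair b₀ e| := Finset.sum_nonneg fun e _ => abs_nonneg _
    have hLpos : 0 < L := by
      have := abs_nonneg (ipair b₀ e₀)
      omega
    refine ⟨b₀ + L • e₀, ?_, ?_⟩
    · simp only [Pi.add_apply, Pi.smul_apply, smul_eq_mul, Finset.sum_add_distrib, ← Finset.mul_sum,
        hb₀, he₀tr, mul_zero, add_zero]
    · intro e he
      have hlin : ipair (b₀ + L • e₀) e = ipair b₀ e + L * ipair e₀ e := by
        simp only [ipair_apply, Pi.add_apply, Pi.smul_apply, smul_eq_mul, add_mul,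
          Finset.sum_add_distrib, mul_assoc, ← Finset.mul_sum]
      rw [hlin]
      rcases Finset.mem_insert.mp he with rfl | he'
      · -- `e = e₀`
        intro h
        have h1 : |ipair b₀ e| < L := by rw [hL]; omega
        have h3 : ipair b₀ e = -(L * ipair e e) := by linarith
        have h4 : |ipair b₀ e| = L * ipair e e := by
          rw [h3, abs_neg, abs_of_pos (mul_pos hLpos hpos)]
        have h5 : L ≤ L * ipair e e := le_mul_of_one_le_right hLpos.le hpos
        omega
      · -- `e ∈ E`
        by_cases h0 : ipair e₀ e = 0
        · rw [h0, mul_zero, add_zero]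
          exact hsep e he'
        · intro h
          have h1 : |ipair b₀ e| < L := by
            rw [hL]
            have := Finset.single_le_sum (f := fun e => |ipair b₀ e|) (fun e _ => abs_nonneg _) he'
            have h' := abs_nonneg (ipair b₀ e₀)
            omega
          have h2 : |ipair b₀ e| = L * |ipair e₀ e| := by
            have : ipair b₀ e = -(L * ipair e₀ e) := by linarith
            rw [this, abs_neg, abs_mul, abs_of_pos hLpos]
          have h3 : 1 ≤ |ipair e₀ e| := Int.one_le_abs h0
          nlinarith

section Weights

variable [DecidableEq σ]

/-! ### §2. Traceless torus weights of the coordinates of `Sym^D` -/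

/-- A degree-`D` exponent vector sums to `D`. [cite: Kempf1978, §2 (weights of `T` on `X`)] -/
theorem sum_degIdx_eq (d : DegIdx σ D) : ∑ i, d.1 i = D := by
  have h := mem_degMonomials_iff.mp d.2
  rwa [Finsupp.degree_eq_sum] at h

/-- The **traceless torus weight** of the coordinate `y_d` of `Sym^D (K^σ)` (`d` a monomial of
degree `D`): `twt d = N·d − D·𝟙`, `N = |σ|`. The diagonal torus `D_SL = {diag(β) : ∏ β = 1}` of
`SL_σ` acts on `y_d` through the character `β ↦ β^d`, and two monomials in the `y_d` have the same
`D_SL`-character iff their total `ℕ^σ`-degrees differ by a multiple of `𝟙`; `N·(−) − (Σ −)·𝟙` is an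
additive map `ℤ^σ → ℤ^σ` with kernel exactly `ℤ·𝟙`, so `twt` records the `D_SL`-character faithfully
(Kempf 1978 §2: the weights of the maximal torus `T` on the representation, here written for the
torus of `SL_σ`). [cite: Kempf1978, §2 (weights of `T` on `X`)] -/
def twt (D : ℕ) (d : DegIdx σ D) : σ → ℤ :=
  fun i => (Fintype.card σ : ℤ) * (d.1 i : ℤ) - (D : ℤ)

/-- Unfolding `twt`. [cite: Kempf1978, §2 (weights of `T` on `X`)] -/
theorem twt_apply (d : DegIdx σ D) (i : σ) :
    twt D d i = (Fintype.card σ : ℤ) * (d.1 i : ℤ) - (D : ℤ) := rfl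

/-- `twt d` is traceless: `∑_i twt d i = 0`. [cite: Kempf1978, §2 (weights of `T` on `X`)] -/
theorem sum_twt (d : DegIdx σ D) : ∑ i, twt D d i = 0 := by
  simp only [twt_apply, Finset.sum_sub_distrib, ← Finset.mul_sum, Finset.sum_const, Finset.card_univ,
    nsmul_eq_mul]
  rw [← Nat.cast_sum, sum_degIdx_eq d]
  ring

/-- The weight `∑_d e_d • twt d` of a monomial `y^e` on `Sym^D` is traceless.
[cite: Kempf1978, §2 (weights of `T` on `X`)] -/
theorem sum_weight_twt (e : DegIdx σ D →₀ ℕ) : ∑ i, Finsupp.weight (twt D) e i = 0 := by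
  rw [Finsupp.weight_apply, Finsupp.sum]
  simp only [Finset.sum_apply, Pi.smul_apply]
  simp only [nsmul_eq_mul]
  rw [Finset.sum_comm]
  refine Finset.sum_eq_zero fun d _ => ?_
  rw [← Finset.mul_sum, sum_twt, mul_zero]

/-- The exponent with which the cocharacter `t ↦ diag(t^{N b})` (`∑ b = 0`) acts on the monomial
`y^e` of `Sym^D`-coordinates is `⟨b, weight e⟩`: `∑_d e_d · N⟨b,d⟩ = ⟨b, ∑_d e_d twt d⟩`.
[cite: Kempf1978, §2 (weights of `T` on `X`)] -/
theorem diagWeight_torus_eq_ipair_weight (b : σ → ℤ) (hb : ∑ i, b i = 0) (e : DegIdx σ D →₀ ℕ) :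
    diagWeight (fun d : DegIdx σ D => (Fintype.card σ : ℤ) * diagWeight b d.1) e =
      ipair b (Finsupp.weight (twt D) e) := by
  rw [diagWeight_apply, ipair_apply, Finsupp.weight_apply,
    Finsupp.sum_fintype e (fun i c => c • twt D i) (fun i => zero_smul ℕ (twt D i))]
  simp only [Finset.sum_apply, Pi.smul_apply]
  simp only [nsmul_eq_mul, twt_apply, Finset.mul_sum]
  rw [Finset.sum_comm]
  refine Finset.sum_congr rfl fun d _ => ?_
  rw [diagWeight_apply]
  have h1 : ∑ i, b i * ((e d : ℤ) * ((Fintype.card σ : ℤ) * (d.1 i : ℤ) - (D : ℤ))) =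
      (e d : ℤ) * (Fintype.card σ : ℤ) * ∑ i, b i * (d.1 i : ℤ) - (e d : ℤ) * (D : ℤ) * ∑ i, b i := by
    rw [Finset.mul_sum, Finset.mul_sum, ← Finset.sum_sub_distrib]
    exact Finset.sum_congr rfl fun i _ => by ring
  rw [h1, hb, mul_zero, sub_zero]
  ring

/-! ### §2. The torus action on `Sym^D` coordinates and isobaric test polynomials -/

/-- **Torus scaling of a monomial**: at the point `(t^{N⟨b,d⟩} c_d)_d` the monomial `r·y^e` takes
the value `t^{∑ e_d N⟨b,d⟩} · (r·y^e)(c)`. [cite: Kempf1978, §2 (weights of `T` on `X`)] -/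
theorem aeval_torus_monomial (b : σ → ℤ) {t : K} (ht : t ≠ 0) (c : DegIdx σ D → K)
    (e : DegIdx σ D →₀ ℕ) (r : K) :
    aeval (fun d : DegIdx σ D => t ^ ((Fintype.card σ : ℤ) * diagWeight b d.1) * c d)
        (monomial e r) =
      t ^ diagWeight (fun d : DegIdx σ D => (Fintype.card σ : ℤ) * diagWeight b d.1) e *
        aeval c (monomial e r) := by
  rw [aeval_monomial, aeval_monomial, Finsupp.prod_fintype _ _ (fun _ => pow_zero _),
    Finsupp.prod_fintype _ _ (fun _ => pow_zero _)]
  simp only [mul_pow, Finset.prod_mul_distrib]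
  have hprod : ∏ d : DegIdx σ D, (t ^ ((Fintype.card σ : ℤ) * diagWeight b d.1)) ^ e d =
      t ^ diagWeight (fun d : DegIdx σ D => (Fintype.card σ : ℤ) * diagWeight b d.1) e := by
    have := prod_units_zpow_pow (Units.mk0 t ht)
      (fun d : DegIdx σ D => (Fintype.card σ : ℤ) * diagWeight b d.1) e
    simpa only [Units.val_zpow_eq_zpow_val, Units.val_mk0] using this
  rw [hprod, Algebra.algebraMap_self, RingHom.id_apply]
  ring

/-- **Torus scaling of an isobaric test polynomial** (Kempf §2: `T` acts on the weight space of
weight `χ` through `χ`): if `f ∈ K[Y_D]` is isobaric of class `m` for `twt` and `∑ b = 0`, then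
`f((t^{N⟨b,d⟩} c_d)_d) = t^{⟨b,m⟩} f(c)` for `t ≠ 0`. [cite: Kempf1978, §2 (weights of `T` on `X`)] -/
theorem aeval_torus_of_isWeightedHomogeneous (b : σ → ℤ) (hb : ∑ i, b i = 0) {t : K} (ht : t ≠ 0)
    (c : DegIdx σ D → K) {f : MvPolynomial (DegIdx σ D) K} {m : σ → ℤ}
    (hf : IsWeightedHomogeneous (twt D) f m) :
    aeval (fun d : DegIdx σ D => t ^ ((Fintype.card σ : ℤ) * diagWeight b d.1) * c d) f =
      t ^ ipair b m * aeval c f := by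
  conv_lhs => rw [f.as_sum]
  conv_rhs => rw [f.as_sum]
  rw [map_sum, map_sum, Finset.mul_sum]
  refine Finset.sum_congr rfl fun e he => ?_
  rw [aeval_torus_monomial b ht c e, diagWeight_torus_eq_ipair_weight b hb e,
    hf (mem_support_iff.mp he)]

/-! ### §3. The vanishing ideal of a `D_SL`-stable set is graded (generic cocharacter) -/

/-! ### §4. The vanishing ideal of a `D_SL`-stable subset of `Sym^D` is graded -/

/-- **The ideal of a torus-stable closed set is spanned by isobaric polynomials** (Kempf §2–§3 works
throughout with `T`-weight decompositions; here: if `S' ⊆ Sym^D` is stable under the cocharacters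
`t ↦ diag(t^{N b})`, `∑ b = 0`, of `D_SL ⊆ SL_σ`, then every isobaric component — for the traceless
weight `twt` — of a polynomial vanishing on `S'` vanishes on `S'`). Proof: restrict to the generic
cocharacter `b` separating the finitely many classes occurring (`exists_traceless_ipair_ne_zero`);
`t ↦ f(t^{Nb}·c) = ∑_m t^{⟨b,m⟩} f_m(c)` is then a Laurent polynomial in `t` with distinct exponents
vanishing on `K^×` (`K` infinite), so all `f_m(c) = 0`. [cite: Kempf1978, §2 (weights of `T` on `X`)] -/
theorem aeval_weightedHomogeneousComponent_eq_zero_of_torusStable [Infinite K]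
    {S' : Set (DegIdx σ D → K)}
    (hS : ∀ b : σ → ℤ, ∑ i, b i = 0 → ∀ t : K, t ≠ 0 → ∀ c ∈ S',
      (fun d : DegIdx σ D => t ^ ((Fintype.card σ : ℤ) * diagWeight b d.1) * c d) ∈ S')
    {f : MvPolynomial (DegIdx σ D) K} (hf : ∀ c ∈ S', aeval c f = 0) (m : σ → ℤ)
    {c : DegIdx σ D → K} (hc : c ∈ S') :
    aeval c (weightedHomogeneousComponent (twt D) m f) = 0 := by
  classical
  -- the classes occurring in `f`
  set Ms : Finset (σ → ℤ) := f.support.image (Finsupp.weight (twt D)) with hMs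
  have hcomp0 : ∀ m', m' ∉ Ms → weightedHomogeneousComponent (twt D) m' f = 0 := fun m' hm' =>
    weightedHomogeneousComponent_eq_zero' m' f fun d hd h => hm' (h ▸ Finset.mem_image_of_mem _ hd)
  by_cases hm : m ∈ Ms
  swap
  · rw [hcomp0 m hm, map_zero]
  -- a cocharacter separating the classes
  obtain ⟨b, hb, hsep⟩ := exists_traceless_ipair_ne_zero
    (((Ms ×ˢ Ms).filter fun p => p.1 ≠ p.2).image fun p => p.1 - p.2) (by
      intro e he
      obtain ⟨p, hp, rfl⟩ := Finset.mem_image.mp he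
      obtain ⟨hp', hne⟩ := Finset.mem_filter.mp hp
      obtain ⟨h1, h2⟩ := Finset.mem_product.mp hp'
      refine ⟨?_, sub_ne_zero.mpr hne⟩
      obtain ⟨e1, -, he1⟩ := Finset.mem_image.mp h1
      obtain ⟨e2, -, he2⟩ := Finset.mem_image.mp h2
      rw [← he1, ← he2]
      simp only [Pi.sub_apply, Finset.sum_sub_distrib, sum_weight_twt, sub_zero])
  have hinj : ∀ m₁ ∈ Ms, ∀ m₂ ∈ Ms, ipair b m₁ = ipair b m₂ → m₁ = m₂ := by
    intro m₁ h1 m₂ h2 h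
    by_contra hne
    refine hsep (m₁ - m₂) (Finset.mem_image.mpr ⟨(m₁, m₂),
      Finset.mem_filter.mpr ⟨Finset.mem_product.mpr ⟨h1, h2⟩, hne⟩, rfl⟩) ?_
    rw [ipair_sub, h, sub_self]
  -- `f` is the sum of its components over `Ms`
  have hdec : ∑ m' ∈ Ms, weightedHomogeneousComponent (twt D) m' f = f := by
    conv_rhs => rw [← sum_weightedHomogeneousComponent (twt D) f]
    rw [finsum_eq_sum_of_support_subset]
    intro m' hm'
    rw [Function.mem_support] at hm'
    rw [Finset.mem_coe]
    by_contra hnot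
    exact hm' (hcomp0 m' hnot)
  -- shift of exponents
  set B : ℤ := ∑ m' ∈ Ms, |ipair b m'| with hB
  have hBle : ∀ m' ∈ Ms, 0 ≤ ipair b m' + B := by
    intro m' hm'
    have h1 := Finset.single_le_sum (f := fun m' => |ipair b m'|) (fun _ _ => abs_nonneg _) hm'
    have h2 := neg_abs_le (ipair b m')
    omega
  -- the one-variable polynomial `t ↦ t^B f(t^{Nb}·c)`
  set P : K[X] := ∑ m' ∈ Ms, Polynomial.C (aeval c (weightedHomogeneousComponent (twt D) m' f)) *
    Polynomial.X ^ (ipair b m' + B).toNat with hP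
  have hPeval : ∀ t : K, t ≠ 0 → P.eval t = 0 := by
    intro t ht
    have h0 : aeval (fun d : DegIdx σ D => t ^ ((Fintype.card σ : ℤ) * diagWeight b d.1) * c d) f =
        0 := hf _ (hS b hb t ht c hc)
    rw [← hdec, map_sum] at h0
    have h1 : ∑ m' ∈ Ms, t ^ ipair b m' * aeval c (weightedHomogeneousComponent (twt D) m' f) =
        0 := by
      rw [← h0]
      refine Finset.sum_congr rfl fun m' _ => ?_
      rw [aeval_torus_of_isWeightedHomogeneous b hb ht c
        (weightedHomogeneousComponent_isWeightedHomogeneous m' f)]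
    rw [hP, Polynomial.eval_finsetSum]
    simp only [Polynomial.eval_mul, Polynomial.eval_C, Polynomial.eval_pow, Polynomial.eval_X]
    have h2 : ∑ m' ∈ Ms, aeval c (weightedHomogeneousComponent (twt D) m' f) *
        t ^ (ipair b m' + B).toNat =
        t ^ B * ∑ m' ∈ Ms, t ^ ipair b m' * aeval c (weightedHomogeneousComponent (twt D) m' f) := by
      rw [Finset.mul_sum]
      refine Finset.sum_congr rfl fun m' hm' => ?_
      rw [← zpow_natCast, Int.toNat_of_nonneg (hBle m' hm'), zpow_add₀ ht]
      ring
    rw [h2, h1, mul_zero]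
  have hP0 : P = 0 := by
    apply Polynomial.eq_zero_of_infinite_isRoot
    apply Set.Infinite.mono (s := {t : K | t ≠ 0})
    · intro t ht
      rw [Set.mem_setOf_eq, Polynomial.IsRoot.def]
      exact hPeval t ht
    · exact (Set.finite_singleton (0 : K)).infinite_compl
  -- the coefficient of `t^{⟨b,m⟩ + B}` is `f_m(c)`
  have hcoeff : P.coeff (ipair b m + B).toNat =
      aeval c (weightedHomogeneousComponent (twt D) m f) := by
    rw [hP, Polynomial.finsetSum_coeff]
    simp only [Polynomial.coeff_C_mul, Polynomial.coeff_X_pow]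
    rw [Finset.sum_eq_single m]
    · rw [if_pos rfl, mul_one]
    · intro m' hm' hne
      rw [if_neg, mul_zero]
      intro h
      apply hne
      apply hinj m' hm' m hm
      have h' := congrArg (fun n : ℕ => (n : ℤ)) h
      simp only [Int.toNat_of_nonneg (hBle m' hm'), Int.toNat_of_nonneg (hBle m hm)] at h'
      linarith
    · intro h
      exact absurd hm h
  rw [← hcoeff, hP0, Polynomial.coeff_zero]

/-- **The vanishing ideal of a `D_SL`-stable subset of `Sym^D` is `twt`-graded**: every isobaric
component of a polynomial vanishing on `S'` vanishes on `S'` (`K` infinite).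
[cite: Kempf1978, §2 (weights of `T` on `X`)] -/
theorem weightedHomogeneousComponent_mem_vanishingIdeal [Infinite K] {S' : Set (DegIdx σ D → K)}
    (hS : ∀ b : σ → ℤ, ∑ i, b i = 0 → ∀ t : K, t ≠ 0 → ∀ c ∈ S',
      (fun d : DegIdx σ D => t ^ ((Fintype.card σ : ℤ) * diagWeight b d.1) * c d) ∈ S')
    {f : MvPolynomial (DegIdx σ D) K} (hf : f ∈ MvPolynomial.vanishingIdeal K S') (m : σ → ℤ) :
    weightedHomogeneousComponent (twt D) m f ∈ MvPolynomial.vanishingIdeal K S' := by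
  rw [MvPolynomial.mem_vanishingIdeal_iff] at hf ⊢
  exact fun c hc => aeval_weightedHomogeneousComponent_eq_zero_of_torusStable hS hf m hc

/-- **Finitely many isobaric generators** (Hilbert's basis theorem + the grading): the vanishing
ideal of a `D_SL`-stable `S' ⊆ Sym^D` is spanned, as an ideal, by finitely many `twt`-isobaric
polynomials `f_1, …, f_r` of classes `m_1, …, m_r`, each vanishing on `S'` (Kempf §3: the finitely
many `T`-weights / "states" through which the numerical function is computed).
[cite: Kempf1978, §2–§3 (weights of `T`; Lemma 3.2)] -/
theorem exists_isobaric_span_vanishingIdeal [Infinite K] {S' : Set (DegIdx σ D → K)}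
    (hS : ∀ b : σ → ℤ, ∑ i, b i = 0 → ∀ t : K, t ≠ 0 → ∀ c ∈ S',
      (fun d : DegIdx σ D => t ^ ((Fintype.card σ : ℤ) * diagWeight b d.1) * c d) ∈ S') :
    ∃ (r : ℕ) (f : Fin r → MvPolynomial (DegIdx σ D) K) (m : Fin r → σ → ℤ),
      (∀ j, f j ∈ MvPolynomial.vanishingIdeal K S') ∧
      (∀ j, IsWeightedHomogeneous (twt D) (f j) (m j)) ∧
      Ideal.span (Set.range f) = MvPolynomial.vanishingIdeal K S' := by
  classical
  set I := MvPolynomial.vanishingIdeal K S' with hI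
  obtain ⟨G, hG⟩ : I.FG := (isNoetherianRing_iff_ideal_fg _).mp inferInstance I
  -- pairs (class, component) of the generators
  set T : Finset ((σ → ℤ) × MvPolynomial (DegIdx σ D) K) := G.biUnion fun g =>
    (g.support.image (Finsupp.weight (twt D))).image fun m' =>
      (m', weightedHomogeneousComponent (twt D) m' g) with hT
  have hTmem : ∀ p ∈ T, p.2 ∈ I ∧ IsWeightedHomogeneous (twt D) p.2 p.1 := by
    intro p hp
    rw [hT, Finset.mem_biUnion] at hp
    obtain ⟨g, hg, hp⟩ := hp
    obtain ⟨m', -, rfl⟩ := Finset.mem_image.mp hp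
    refine ⟨?_, weightedHomogeneousComponent_isWeightedHomogeneous m' g⟩
    have hgI : g ∈ I := hG ▸ Ideal.subset_span hg
    exact weightedHomogeneousComponent_mem_vanishingIdeal hS hgI m'
  refine ⟨T.card, fun j => (T.equivFin.symm j).1.2, fun j => (T.equivFin.symm j).1.1,
    fun j => (hTmem _ (T.equivFin.symm j).2).1, fun j => (hTmem _ (T.equivFin.symm j).2).2, ?_⟩
  apply le_antisymm
  · rw [Ideal.span_le]
    rintro _ ⟨j, rfl⟩
    exact (hTmem _ (T.equivFin.symm j).2).1
  · rw [← hG, Ideal.span_le]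
    intro g hg
    -- `g` is the sum of its components, each of which is some `f j`
    have hdec : ∑ m' ∈ g.support.image (Finsupp.weight (twt D)),
        weightedHomogeneousComponent (twt D) m' g = g := by
      conv_rhs => rw [← sum_weightedHomogeneousComponent (twt D) g]
      rw [finsum_eq_sum_of_support_subset]
      intro m' hm'
      rw [Function.mem_support] at hm'
      rw [Finset.mem_coe]
      by_contra hnot
      exact hm' (weightedHomogeneousComponent_eq_zero' m' g fun d hd h =>
        hnot (h ▸ Finset.mem_image_of_mem _ hd))
    rw [SetLike.mem_coe, ← hdec]
    refine Ideal.sum_mem _ fun m' hm' => ?_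
    have hmemT : (m', weightedHomogeneousComponent (twt D) m' g) ∈ T := by
      rw [hT, Finset.mem_biUnion]
      exact ⟨g, hg, Finset.mem_image_of_mem _ hm'⟩
    refine Ideal.subset_span ⟨T.equivFin ⟨_, hmemT⟩, ?_⟩
    simp only [Equiv.symm_apply_apply]

/-! ### §5. Pulling back test polynomials along the action of `Mat_σ(K)` on `Sym^D` -/

/-- **The degree-`D` coefficients of `g·u` are linear in those of `u`** with matrix
`(coeff_d (g·x^e))_{d,e}` — the matrix of `g` acting on `Sym^D` (monomials of other degrees do not
contribute: `g·x^e` is homogeneous of degree `|e|`). [cite: Kempf1978, §1 (the linear action on `X`)] -/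
theorem formCoeff_linSubst (g : Matrix σ σ K) (u : MvPolynomial σ K) (d : DegIdx σ D) :
    formCoeff D (linSubst σ K g u) d =
      ∑ e : DegIdx σ D, coeff d.1 (linSubst σ K g (monomial e.1 1)) * formCoeff D u e := by
  classical
  have hdD : d.1.degree = D := mem_degMonomials_iff.mp d.2
  rw [formCoeff_apply]
  conv_lhs => rw [u.as_sum, map_sum, coeff_sum]
  have hterm : ∀ e : σ →₀ ℕ, coeff d.1 (linSubst σ K g (monomial e (coeff e u))) =
      coeff d.1 (linSubst σ K g (monomial e 1)) * coeff e u := by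
    intro e
    rw [← mul_one (coeff e u), ← C_mul_monomial, map_mul, linSubst_C, coeff_C_mul, mul_one, mul_comm]
  simp_rw [hterm]
  -- only degree-`D` monomials contribute
  have hvan : ∀ e ∈ u.support, e ∉ degMonomials σ D →
      coeff d.1 (linSubst σ K g (monomial e 1)) * coeff e u = 0 := by
    intro e _ he
    rw [(linSubst_isHomogeneous g (isHomogeneous_monomial (n := e.degree) (1 : K) rfl)).coeff_eq_zero
      (fun h => he (mem_degMonomials_iff.mpr (h.symm.trans hdD))), zero_mul]
  rw [← Finset.sum_filter_of_ne (s := u.support) (p := fun e => e ∈ degMonomials σ D)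
    (fun e he hne => by
      by_contra h
      exact hne (hvan e he h)),
    Finset.filter_mem_eq_inter, Finset.inter_comm, ← Finset.filter_mem_eq_inter,
    Finset.sum_filter_of_ne (fun e _ hne => by
      by_contra h
      rw [notMem_support_iff.mp h, mul_zero] at hne
      exact hne rfl),
    ← Finset.sum_coe_sort]
  rfl

/-- **The pullback of a test polynomial along `g` acting on `Sym^D`** (`(f ∘ g)(y) = f(g·y)`):
substitute for `y_d` the linear form `∑_e coeff_d(g·x^e) y_e`.
[cite: Kempf1978, §1 (the linear action on `X` and on `k[X]`)] -/
def symPullback (D : ℕ) (g : Matrix σ σ K) :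
    MvPolynomial (DegIdx σ D) K →ₐ[K] MvPolynomial (DegIdx σ D) K :=
  aeval fun d : DegIdx σ D => ∑ e : DegIdx σ D, coeff d.1 (linSubst σ K g (monomial e.1 1)) • X e

/-- `symPullback` on a variable. [cite: Kempf1978, §1 (the linear action on `k[X]`)] -/
theorem symPullback_X (g : Matrix σ σ K) (d : DegIdx σ D) :
    symPullback D g (X d) = ∑ e : DegIdx σ D, coeff d.1 (linSubst σ K g (monomial e.1 1)) • X e :=
  aeval_X _ d

/-- **Evaluation of the pullback**: `(symPullback g f)(u) = f(g·u)` on degree-`D` coefficient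
vectors. [cite: Kempf1978, §1 (the linear action on `k[X]`)] -/
theorem aeval_formCoeff_symPullback (g : Matrix σ σ K) (u : MvPolynomial σ K)
    (f : MvPolynomial (DegIdx σ D) K) :
    aeval (formCoeff D u) (symPullback D g f) = aeval (formCoeff D (linSubst σ K g u)) f := by
  have hfun : (fun d : DegIdx σ D => aeval (formCoeff D u)
      (∑ e : DegIdx σ D, coeff d.1 (linSubst σ K g (monomial e.1 1)) •
        (X e : MvPolynomial (DegIdx σ D) K))) =
      formCoeff D (linSubst σ K g u) := by
    funext d
    rw [map_sum, formCoeff_linSubst]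
    refine Finset.sum_congr rfl fun e _ => ?_
    rw [map_smul, aeval_X, smul_eq_mul]
  rw [symPullback, ← AlgHom.comp_apply, comp_aeval, hfun]

end Weights

/-! ### §6. Weight bounds for substitutions (the monomial bookkeeping behind Kempf's Lemma 3.2 (c)) -/

section WeightBounds

variable {τ τ' : Type*} {R : Type*} [CommSemiring R]

/-- Negating the weights negates the weight of a monomial. [folklore] -/
private theorem kempfWeight_neg (ω : τ → ℝ) (e : τ →₀ ℕ) :
    Finsupp.weight (-ω) e = -Finsupp.weight ω e := by
  simp only [Finsupp.weight_apply, Finsupp.sum, Pi.neg_apply, smul_neg, Finset.sum_neg_distrib]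

/-- Weight bound for a product: if all monomials of `φ` have `ω`-weight `≤ r` and those of `ψ`
have weight `≤ s`, those of `φψ` have weight `≤ r + s`. [folklore] -/
private theorem weight_le_of_mem_support_mul {ω : τ → ℝ} {φ ψ : MvPolynomial τ R} {r s : ℝ}
    (hφ : ∀ e ∈ φ.support, Finsupp.weight ω e ≤ r) (hψ : ∀ e ∈ ψ.support, Finsupp.weight ω e ≤ s) :
    ∀ e ∈ (φ * ψ).support, Finsupp.weight ω e ≤ r + s := by
  classical
  intro e he
  rw [mem_support_iff, coeff_mul] at he
  obtain ⟨p, hp, hne⟩ := Finset.exists_ne_zero_of_sum_ne_zero he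
  rw [Finset.HasAntidiagonal.mem_antidiagonal] at hp
  have h1 : p.1 ∈ φ.support := mem_support_iff.mpr (left_ne_zero_of_mul hne)
  have h2 : p.2 ∈ ψ.support := mem_support_iff.mpr (right_ne_zero_of_mul hne)
  rw [← hp, map_add]
  exact add_le_add (hφ _ h1) (hψ _ h2)

/-- Weight bound for a finite product. [folklore] -/
private theorem weight_le_of_mem_support_prod {ι : Type*} {ω : τ → ℝ} (s : Finset ι)
    (φ : ι → MvPolynomial τ R) (r : ι → ℝ)
    (h : ∀ i ∈ s, ∀ e ∈ (φ i).support, Finsupp.weight ω e ≤ r i) :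
    ∀ e ∈ (∏ i ∈ s, φ i).support, Finsupp.weight ω e ≤ ∑ i ∈ s, r i := by
  classical
  induction s using Finset.induction_on with
  | empty =>
    intro e he
    rw [Finset.prod_empty, mem_support_iff, coeff_one] at he
    have : e = 0 := by
      by_contra hne
      exact he (if_neg (fun h => hne h.symm))
    rw [this, map_zero, Finset.sum_empty]
  | insert i s hi ih =>
    intro e he
    rw [Finset.prod_insert hi] at he
    rw [Finset.sum_insert hi]
    exact weight_le_of_mem_support_mul (h i (Finset.mem_insert_self i s))
      (ih fun j hj => h j (Finset.mem_insert_of_mem hj)) e he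

/-- Weight bound for a power. [folklore] -/
private theorem weight_le_of_mem_support_pow {ω : τ → ℝ} {φ : MvPolynomial τ R} {r : ℝ}
    (hφ : ∀ e ∈ φ.support, Finsupp.weight ω e ≤ r) (n : ℕ) :
    ∀ e ∈ (φ ^ n).support, Finsupp.weight ω e ≤ n * r := by
  classical
  induction n with
  | zero =>
    intro e he
    rw [pow_zero, mem_support_iff, coeff_one] at he
    have : e = 0 := by
      by_contra hne
      exact he (if_neg (fun h => hne h.symm))
    rw [this, map_zero, Nat.cast_zero, zero_mul]
  | succ n ih =>
    intro e he
    rw [pow_succ] at he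
    have h := weight_le_of_mem_support_mul ih hφ e he
    push_cast
    linarith

/-- Weight bound for a finite sum. [folklore] -/
private theorem weight_le_of_mem_support_sum {ι : Type*} {ω : τ → ℝ} (s : Finset ι)
    (φ : ι → MvPolynomial τ R) {r : ℝ}
    (h : ∀ i ∈ s, ∀ e ∈ (φ i).support, Finsupp.weight ω e ≤ r) :
    ∀ e ∈ (∑ i ∈ s, φ i).support, Finsupp.weight ω e ≤ r := by
  classical
  intro e he
  rw [mem_support_iff, coeff_sum] at he
  obtain ⟨i, hi, hne⟩ := Finset.exists_ne_zero_of_sum_ne_zero he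
  exact h i hi e (mem_support_iff.mpr hne)

/-- **Weight bound for a substitution** (upper form): if each substituted polynomial `φ t` only has
monomials of `ω'`-weight `≤ ω t`, then substituting into a polynomial all of whose monomials have
`ω`-weight `≤ r` yields monomials of `ω'`-weight `≤ r`. [folklore] -/
private theorem weight_le_of_mem_support_aeval {ω : τ → ℝ} {ω' : τ' → ℝ} (φ : τ → MvPolynomial τ' R)
    (hφ : ∀ t, ∀ e ∈ (φ t).support, Finsupp.weight ω' e ≤ ω t) (f : MvPolynomial τ R) {r : ℝ}
    (hf : ∀ e ∈ f.support, Finsupp.weight ω e ≤ r) :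
    ∀ e' ∈ (aeval φ f).support, Finsupp.weight ω' e' ≤ r := by
  classical
  conv => enter [e']; rw [f.as_sum, map_sum]
  apply weight_le_of_mem_support_sum
  intro e he e' he'
  rw [aeval_monomial, MvPolynomial.algebraMap_eq] at he'
  have he'' : e' ∈ (e.prod fun t k => φ t ^ k).support := by
    rw [mem_support_iff] at he' ⊢
    rw [coeff_C_mul] at he'
    exact right_ne_zero_of_mul he'
  rw [Finsupp.prod] at he''
  refine le_trans (weight_le_of_mem_support_prod e.support (fun t => φ t ^ e t)
    (fun t => (e t : ℝ) * ω t) (fun t _ => ?_) e' he'') ?_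
  · -- powers
    exact weight_le_of_mem_support_pow (hφ t) (e t)
  · have hw : ∑ t ∈ e.support, (e t : ℝ) * ω t = Finsupp.weight ω e := by
      rw [Finsupp.weight_apply, Finsupp.sum]
      exact Finset.sum_congr rfl fun t _ => (nsmul_eq_mul _ _).symm
    rw [hw]
    exact hf e he

/-- **Weight bound for a substitution** (lower form). [folklore] -/
private theorem le_weight_of_mem_support_aeval {ω : τ → ℝ} {ω' : τ' → ℝ} (φ : τ → MvPolynomial τ' R)
    (hφ : ∀ t, ∀ e ∈ (φ t).support, ω t ≤ Finsupp.weight ω' e) (f : MvPolynomial τ R) {r : ℝ}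
    (hf : ∀ e ∈ f.support, r ≤ Finsupp.weight ω e) :
    ∀ e' ∈ (aeval φ f).support, r ≤ Finsupp.weight ω' e' := by
  intro e' he'
  have h := weight_le_of_mem_support_aeval (ω := -ω) (ω' := -ω') φ
    (fun t e he => by rw [kempfWeight_neg, Pi.neg_apply]; exact neg_le_neg (hφ t e he)) f (r := -r)
    (fun e he => by rw [kempfWeight_neg]; exact neg_le_neg (hf e he)) e' he'
  rw [kempfWeight_neg] at h
  exact neg_le_neg_iff.mp h

end WeightBounds

section Substitutions

variable [DecidableEq σ]

omit [DecidableEq σ] in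
/-- The `a`-weight `∑ a_i d_i` of a monomial `x^d` (the pairing of the cocharacter `a` with the
character `d` of `T` on `x^d`) is `Finsupp.weight a d`. [cite: Kempf1978, §2 (the pairing of one-parameter subgroups and characters)] -/
theorem weight_eq_sum (a : σ → ℝ) (d : σ →₀ ℕ) :
    Finsupp.weight a d = ∑ i, a i * (d i : ℝ) := by
  rw [Finsupp.weight_apply, Finsupp.sum_fintype d (fun i c => c • a i) (fun i => zero_smul ℕ (a i))]
  exact Finset.sum_congr rfl fun i _ => by rw [nsmul_eq_mul, mul_comm]

/-- **Matrices compatible with two weight vectors raise weights** (lower form): if `q_{ij} ≠ 0`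
implies `ω_j ≤ ω'_i` (the variable `x_j` is sent to variables of `ω'`-weight at least `ω_j`), then
every monomial of `q·f` has `ω'`-weight `≥ r` as soon as every monomial of `f` has `ω`-weight
`≥ r`. For `ω = ω' = a` this is the parabolic subgroup `P_a = {q : a_i < a_j ⇒ q_{ij} = 0}`
(Kempf §2: `P(λ)`); for a monomial matrix it is the Weyl group moving the weights.
[cite: Kempf1978, §2 (`P(λ)`)] -/
theorem le_weight_of_mem_support_linSubst {q : Matrix σ σ K} {ω ω' : σ → ℝ}
    (hq : ∀ i j, q i j ≠ 0 → ω j ≤ ω' i) {f : MvPolynomial σ K} {r : ℝ}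
    (hf : ∀ e ∈ f.support, r ≤ Finsupp.weight ω e) :
    ∀ d ∈ (linSubst σ K q f).support, r ≤ Finsupp.weight ω' d := by
  classical
  refine le_weight_of_mem_support_aeval _ (fun j d hd => ?_) f hf
  -- monomials of `∑_i q i j • X i` are the `X i` with `q i j ≠ 0`
  rw [mem_support_iff, coeff_sum] at hd
  obtain ⟨i, -, hne⟩ := Finset.exists_ne_zero_of_sum_ne_zero hd
  rw [coeff_smul, coeff_X, smul_eq_mul] at hne
  have hdi : Finsupp.single i 1 = d := by
    by_contra h
    rw [if_neg h, mul_zero] at hne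
    exact hne rfl
  have hqij : q i j ≠ 0 := by
    rw [if_pos hdi, mul_one] at hne
    exact hne
  rw [← hdi, Finsupp.weight_single, one_smul]
  exact hq i j hqij

/-- **Matrices compatible with two weight vectors lower weights** (upper form, `q_{ij} ≠ 0 ⇒
ω'_i ≤ ω_j`). [cite: Kempf1978, §2 (`P(λ)`)] -/
theorem weight_le_of_mem_support_linSubst {q : Matrix σ σ K} {ω ω' : σ → ℝ}
    (hq : ∀ i j, q i j ≠ 0 → ω' i ≤ ω j) {f : MvPolynomial σ K} {r : ℝ}
    (hf : ∀ e ∈ f.support, Finsupp.weight ω e ≤ r) :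
    ∀ d ∈ (linSubst σ K q f).support, Finsupp.weight ω' d ≤ r := by
  classical
  refine weight_le_of_mem_support_aeval _ (fun j d hd => ?_) f hf
  rw [mem_support_iff, coeff_sum] at hd
  obtain ⟨i, -, hne⟩ := Finset.exists_ne_zero_of_sum_ne_zero hd
  rw [coeff_smul, coeff_X, smul_eq_mul] at hne
  have hdi : Finsupp.single i 1 = d := by
    by_contra h
    rw [if_neg h, mul_zero] at hne
    exact hne rfl
  have hqij : q i j ≠ 0 := by
    rw [if_pos hdi, mul_one] at hne
    exact hne
  rw [← hdi, Finsupp.weight_single, one_smul]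
  exact hq i j hqij

/-- **The parabolic `P_a` raises monomial weights**: if `a_i < a_j ⇒ q_{ij} = 0` then every
monomial `x^d` of `q·x^e` has `⟨a,d⟩ ≥ ⟨a,e⟩`. [cite: Kempf1978, §2 (`P(λ)`)] -/
theorem le_weight_of_coeff_linSubst_monomial_ne_zero {q : Matrix σ σ K} {a : σ → ℝ}
    (hq : ∀ i j, q i j ≠ 0 → a j ≤ a i) {d e : σ →₀ ℕ}
    (h : coeff d (linSubst σ K q (monomial e 1)) ≠ 0) :
    ∑ i, a i * (e i : ℝ) ≤ ∑ i, a i * (d i : ℝ) := by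
  classical
  rw [← weight_eq_sum, ← weight_eq_sum]
  refine le_weight_of_mem_support_linSubst hq (f := monomial e (1 : K)) (fun e' he' => ?_) d
    (mem_support_iff.mpr h)
  rw [support_monomial, if_neg one_ne_zero, Finset.mem_singleton] at he'
  rw [he']

/-- **Monomial matrices move monomial weights by the permutation**: for the signed permutation
matrix `q_{ij} = [i = π j] ε_j` (`x_j ↦ ε_j x_{π j}`), a monomial `x^d` of `q·x^e` has
`⟨a, d⟩ = ⟨a ∘ π, e⟩`. [cite: Kempf1978, §2 (the Weyl group acting on `X_*(T)`)] -/
theorem weight_eq_of_coeff_linSubst_monomial_ne_zero_of_perm {q : Matrix σ σ K} {π : Equiv.Perm σ}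
    (hq : ∀ i j, q i j ≠ 0 → i = π j) (a : σ → ℝ) {d e : σ →₀ ℕ}
    (h : coeff d (linSubst σ K q (monomial e 1)) ≠ 0) :
    ∑ i, a i * (d i : ℝ) = ∑ j, a (π j) * (e j : ℝ) := by
  classical
  rw [← weight_eq_sum, ← weight_eq_sum]
  have hsupp : ∀ e' ∈ (monomial e (1 : K)).support, e' = e := fun e' he' => by
    rw [support_monomial, if_neg one_ne_zero, Finset.mem_singleton] at he'
    exact he'
  apply le_antisymm
  · exact weight_le_of_mem_support_linSubst (ω := a ∘ π) (ω' := a)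
      (fun i j hij => by rw [Function.comp_apply, ← hq i j hij]) (f := monomial e (1 : K))
      (fun e' he' => by rw [hsupp e' he']; exact le_rfl) d (mem_support_iff.mpr h)
  · exact le_weight_of_mem_support_linSubst (ω := a ∘ π) (ω' := a)
      (fun i j hij => by rw [Function.comp_apply, ← hq i j hij]) (f := monomial e (1 : K))
      (fun e' he' => by rw [hsupp e' he']; exact le_rfl) d (mem_support_iff.mpr h)

/-- The real weight of a test monomial `y^e` for the weights `d ↦ ⟨a, twt d⟩` is `⟨a, weight e⟩`.
[cite: Kempf1978, §2] -/
theorem weight_rpair_twt (a : σ → ℝ) (e : DegIdx σ D →₀ ℕ) :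
    Finsupp.weight (fun d : DegIdx σ D => rpair a (twt D d)) e =
      rpair a (Finsupp.weight (twt D) e) := by
  rw [rpair_weight, Finsupp.weight_apply, Finsupp.sum]
  exact Finset.sum_congr rfl fun d _ => nsmul_eq_mul _ _

/-- Monomials of a linear form `∑_e c_e y_e` are variables `y_e` with `c_e ≠ 0`. [folklore] -/
private theorem exists_eq_single_of_mem_support_sum_smul_X {ι : Type*} [Fintype ι] (c : ι → K)
    {e' : ι →₀ ℕ} (he' : e' ∈ (∑ e : ι, c e • (X e : MvPolynomial ι K)).support) :
    ∃ e, c e ≠ 0 ∧ e' = Finsupp.single e 1 := by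
  classical
  rw [mem_support_iff, coeff_sum] at he'
  obtain ⟨e, -, hne⟩ := Finset.exists_ne_zero_of_sum_ne_zero he'
  rw [coeff_smul, coeff_X, smul_eq_mul] at hne
  by_cases h : Finsupp.single e 1 = e'
  · rw [if_pos h, mul_one] at hne
    exact ⟨e, hne, h.symm⟩
  · rw [if_neg h, mul_zero] at hne
    exact absurd rfl hne

/-- **Pullback along a weight-compatible matrix lowers the weights of test monomials** (the
`Sym^D` form of Kempf's Lemma 3.2 (c) bookkeeping): if `coeff_d(g·x^e) ≠ 0 ⇒ ⟨a', twt e⟩ ≤ ⟨a, twt d⟩`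
then every monomial of `symPullback g f` has `a'`-weight `≤ r` whenever every monomial of `f` has
`a`-weight `≤ r`. [cite: Kempf1978, Lemma 3.2 (c)] -/
theorem rpair_weight_le_of_mem_support_symPullback {g : Matrix σ σ K} {a a' : σ → ℝ}
    (hlow : ∀ d e : DegIdx σ D, coeff d.1 (linSubst σ K g (monomial e.1 1)) ≠ 0 →
      rpair a' (twt D e) ≤ rpair a (twt D d))
    {f : MvPolynomial (DegIdx σ D) K} {r : ℝ}
    (hf : ∀ e ∈ f.support, rpair a (Finsupp.weight (twt D) e) ≤ r) :
    ∀ e' ∈ (symPullback D g f).support, rpair a' (Finsupp.weight (twt D) e') ≤ r := by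
  classical
  intro e' he'
  rw [← weight_rpair_twt]
  refine weight_le_of_mem_support_aeval (ω := fun d => rpair a (twt D d))
    (ω' := fun e => rpair a' (twt D e))
    (fun d : DegIdx σ D => ∑ e : DegIdx σ D, coeff d.1 (linSubst σ K g (monomial e.1 1)) • X e)
    (fun d e'' he'' => ?_) f (r := r) (fun e he => by rw [weight_rpair_twt]; exact hf e he) e' he'
  obtain ⟨e, hce, rfl⟩ := exists_eq_single_of_mem_support_sum_smul_X _ he''
  rw [Finsupp.weight_single, one_smul]
  exact hlow d e hce

/-! ### §7. The degree-`D` coefficient image of an `SL`-orbit is `D_SL`-stable -/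

/-- `diag(t^{N b})` acts on the degree-`D` coefficient vector by `c_d ↦ t^{N⟨b,d⟩} c_d`.
[cite: Kempf1978, §2 (weights of `T` on `X`)] -/
theorem formCoeff_linSubst_diagonal_zpow (t : Kˣ) (b : σ → ℤ) (u : MvPolynomial σ K)
    (d : DegIdx σ D) :
    formCoeff D (linSubst σ K (Matrix.diagonal fun i =>
        ((t ^ ((Fintype.card σ : ℤ) * b i) : Kˣ) : K)) u) d =
      (t : K) ^ ((Fintype.card σ : ℤ) * diagWeight b d.1) * formCoeff D u d := by
  rw [formCoeff_apply, formCoeff_apply,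
    coeff_linSubst_diagonal_zpow t (fun i => (Fintype.card σ : ℤ) * b i) u d.1,
    Units.val_zpow_eq_zpow_val]
  congr 2
  simp only [diagWeight_apply, Finset.mul_sum, mul_assoc]

/-- **The `Sym^D`-image of an `SL`-orbit is stable under the cocharacters of `D_SL`**: the
hypothesis of §4 holds for `S' = formCoeff D '' SL·Q`. [cite: Kempf1978, §2 (weights of `T` on `X`)] -/
theorem formCoeff_image_slOrbit_torusStable (Q : MvPolynomial σ K) :
    ∀ b : σ → ℤ, ∑ i, b i = 0 → ∀ t : K, t ≠ 0 → ∀ c ∈ formCoeff D '' slOrbit σ K Q,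
      (fun d : DegIdx σ D => t ^ ((Fintype.card σ : ℤ) * diagWeight b d.1) * c d) ∈
        formCoeff D '' slOrbit σ K Q := by
  rintro b hb t ht _ ⟨_, ⟨g, rfl⟩, rfl⟩
  have hsum : ∑ i, (Fintype.card σ : ℤ) * b i = 0 := by rw [← Finset.mul_sum, hb, mul_zero]
  obtain ⟨h, hh⟩ := exists_sl_coe_eq_diagonal_zpow (Units.mk0 t ht) hsum
  refine ⟨linSubst σ K ((h * g : Matrix.SpecialLinearGroup σ K) : Matrix σ σ K) Q, ⟨h * g, rfl⟩, ?_⟩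
  funext d
  rw [Matrix.SpecialLinearGroup.coe_mul, linSubst_mul, AlgHom.comp_apply, hh,
    formCoeff_linSubst_diagonal_zpow, Units.val_mk0]

/-- **Isobaric generators of the ideal of `SL·Q` in `Sym^D`** (`K` infinite): finitely many
`twt`-isobaric `f_j`, vanishing on `formCoeff D '' SL·Q`, spanning its vanishing ideal.
[cite: Kempf1978, §2–§3 (weights of `T`; Lemma 3.2)] -/
theorem exists_isobaric_span_vanishingIdeal_slOrbit [Infinite K] (Q : MvPolynomial σ K) :
    ∃ (r : ℕ) (f : Fin r → MvPolynomial (DegIdx σ D) K) (m : Fin r → σ → ℤ),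
      (∀ j, f j ∈ MvPolynomial.vanishingIdeal K (formCoeff D '' slOrbit σ K Q)) ∧
      (∀ j, IsWeightedHomogeneous (twt D) (f j) (m j)) ∧
      Ideal.span (Set.range f) = MvPolynomial.vanishingIdeal K (formCoeff D '' slOrbit σ K Q) :=
  exists_isobaric_span_vanishingIdeal (formCoeff_image_slOrbit_torusStable Q)

/-- **`symPullback` by `g ∈ SL` preserves the ideal of `SL·Q`** (the ideal of a `G`-stable set is
`G`-stable). [cite: Kempf1978, §1 (the linear action on `k[X]`)] -/
theorem symPullback_mem_vanishingIdeal_slOrbit (Q : MvPolynomial σ K) (g : Matrix.SpecialLinearGroup σ K)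
    {f : MvPolynomial (DegIdx σ D) K}
    (hf : f ∈ MvPolynomial.vanishingIdeal K (formCoeff D '' slOrbit σ K Q)) :
    symPullback D (g : Matrix σ σ K) f ∈
      MvPolynomial.vanishingIdeal K (formCoeff D '' slOrbit σ K Q) := by
  rw [MvPolynomial.mem_vanishingIdeal_iff] at hf ⊢
  rintro _ ⟨_, ⟨g', rfl⟩, rfl⟩
  rw [aeval_formCoeff_symPullback, ← AlgHom.comp_apply, ← linSubst_mul,
    ← Matrix.SpecialLinearGroup.coe_mul]
  exact hf _ ⟨_, ⟨g * g', rfl⟩, rfl⟩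

end Substitutions

end Literature.Computability.AlgebraicComplexity
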